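import Summits.ResolutionOfSingularities.KangarooAtlas.MizutaniPBasisTower
import Summits.ResolutionOfSingularities.KangarooAtlas.MizutaniOperatorOrder
import Literature.AlgebraicGeometry.Resolution.SharpOrderCoordinateCentre
import HarnessLib

/-!
# The Hasse–Schmidt operators of a finite `p`-independent family extend to differential operators on `k`

Cell `pub-rosobs`, Mizutani enclosure (seat mizutani-encloser-2, gen 9).  AI-written; *AI review is weaker than expert review*;
NOT a resolution-of-singularities theorem (summit relevance C).

Third step of the route to Mizutani's Lemma 2.4 / 2.7 over fields of infinite `p`-degree (seat HANDOFF § PLAN).  By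
`MizutaniPBasisTower.exists_isRootTower_of_pIndep`, for a finite `p`-independent `b : Fin s → k` and `e ≥ 1` the field `k` is a finite
root tower of order `p^e` with generators `b` over an intermediate field `G ⊇ k^{p^e}` (the complement field of a `p`-basis).  The
`G`-linear Hasse–Schmidt operators `D^{(T)} = h.hsD T` of this tower, restricted to `k^{p^e}`-linear maps, are DIFFERENTIAL OPERATORS
OF `k` OVER `k^{p^e}` OF ORDER `≤ |T|` (Grothendieck's commutator criterion is insensitive to the base ring between `k^{p^e}` and `G`), act on
the monomials of `b` by the universal formula `D^{(T)}(b^N) = C(N,T) b^{N−T}`, and satisfy the Leibniz rule — i.e. they are the EXTENSIONS TO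
`k` of the operators of the finite tower `k^{p^e}(b)` used in encloser-1's proof of Lemma 2.4 (`MizutaniLemma24Tower`), available now
without any hypothesis on the `p`-degree of `k`:

* (restriction of scalars `IsDiffOpLE.restrictScalars` is Literature `SharpOrderCoordinateCentre`: the commutator criterion does not
  see the base between `k^{p^e}` and `G`);
* **`exists_hsFamily_of_pIndep`** — a family `D : (Fin s →₀ ℕ) → (k →ₗ[k^{p^e}] k)` with `D 0 = id`, `IsDiffOpLE (k^{p^e}) |T| (D T)`,
  `D T (b^N) = C(N,T)·b^{N−T}` and the Leibniz rule, for `T` in the box `[0, p^e)^s`.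

References: [Mizutani1973HironakaGroupSchemes] Lemma 2.4 (p. 88); EGA IV₄ 16.8.8, 16.11.2 [EGAIV4].
-/

noncomputable section

open MvPolynomial Literature.AlgebraicGeometry.Resolution Literature.AlgebraicGeometry.Resolution.HironakaScheme

namespace Summit.ResolutionOfSingularities.KangarooAtlas.Mizutani

universe u


section Extension

variable {k : Type u} [Field k] {p : ℕ} [hp : Fact p.Prime] [CharP k p]

/-- **THE HASSE–SCHMIDT OPERATORS OF A FINITE `p`-INDEPENDENT FAMILY EXTEND TO `k`.**  For `b : Fin s → k` `p`-independent and `e ≥ 1`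
there is a family `D_T : k → k` (`T : Fin s →₀ ℕ`) of `k^{p^e}`-linear maps with `D_0 = id`, `D_T` a differential operator of `k` over
`k^{p^e}` of order `≤ |T|`, `D_T(b^N) = C(N,T)·b^{N−T}` for every exponent `N`, and the Leibniz rule `D_T(yz) = Σ_{T₁+T₂=T} D_{T₁}y·D_{T₂}z`
(all for `T` in the box `[0,p^e)^s`) — the Hasse–Schmidt operators of the root tower `k / k^{p^e}(Λ ∖ b)` (`exists_isRootTower_of_pIndep`),
which on the finite tower `k^{p^e}(b)` are its operators `D^{(T)}`.  No hypothesis on `[k : k^p]`.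
[cite: Mizutani1973HironakaGroupSchemes, Lemma 2.4 (p. 88: the operators of K = k^q(c_1, …, c_m) act on k via a p-basis Λ ⊇ {c_i})] -/
theorem exists_hsFamily_of_pIndep {s : ℕ} {b : Fin s → k} (hb : PIndep p 1 b) {e : ℕ} (he : 1 ≤ e) :
    ∃ D : (Fin s →₀ ℕ) → (k →ₗ[frobPow k p e] k),
      D 0 = LinearMap.id ∧
      (∀ T : Fin s →₀ ℕ, InBox (p ^ e) T → IsDiffOpLE (frobPow k p e) T.degree (D T)) ∧
      (∀ T : Fin s →₀ ℕ, InBox (p ^ e) T → ∀ N : Fin s →₀ ℕ,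
        D T (∏ i, b i ^ N i) = (mchoose N T : k) * ∏ i, b i ^ (N i - T i)) ∧
      (∀ T : Fin s →₀ ℕ, InBox (p ^ e) T → ∀ y z : k,
        D T (y * z) = ∑ w ∈ Finset.HasAntidiagonal.antidiagonal T, D w.1 y * D w.2 z) := by
  obtain ⟨G, x, -, h⟩ := exists_isRootTower_of_pIndep hb he
  refine ⟨fun T => (h.hsD T).restrictScalars (frobPow k p e), ?_, fun T hT => ?_, fun T hT N => ?_, fun T hT y z => ?_⟩
  · show (h.hsD 0).restrictScalars (frobPow k p e) = LinearMap.id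
    rw [h.hsD_zero]; rfl
  · exact (h.isDiffOpLE_hsD _ hT le_rfl).restrictScalars
  · rw [LinearMap.restrictScalars_apply, h.hsD_prod_pow hT]
  · simp only [LinearMap.restrictScalars_apply]
    exact h.hsD_mul hT y z

end Extension

end Summit.ResolutionOfSingularities.KangarooAtlas.Mizutani

end
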